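import Summits.AtomisticToContinuum.BoseEinsteinCondensation.Theorems.BECConjugateDominationHardCoreExtensionPairShellMass
import HarnessLib

/-!
# Uniform outer pair-shell mass bound (P4U): stub `stub_pairShellMassBoundUniform` of line `third-law-current-floor`,
# crux `HardCoreExtension` (stmt-AtomisticToContinuum-11786), lead c1

The landed `PairShellMass.shell_estimate` (worker W7, `…PairShellMass.lean`) has the explicit constant `16 N²`, independent of the
core radius `a` and the shell width `ℓ`; hence the constant of `stub_pairShellMassBoundV2` can be chosen uniformly for all
`0 < ℓ ≤ a ≤ a₀` once `4a₀ < L`. This is the input P4U of the soft-core energy convergence `stub_truncationEnergyConvergenceSoft_of`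
(`…AlphaSoft.lean`). [folklore]
-/

noncomputable section

namespace Summit.AtomisticToContinuum.BoseEinsteinCondensation.Cruxes.HardCoreExtension.ThirdLawCurrentFloor

open MeasureTheory Filter
open scoped ENNReal NNReal BigOperators Topology
open Literature.MathematicalPhysics.QuantumManyBody.BoseGas

/-- **P4U (registered `stub_pairShellMassBoundUniform`)**: the outer pair-shell mass bound with a constant uniform over the core
radii `a ≤ a₀` (`C = 16N²`). [folklore] -/
theorem stub_pairShellMassBoundUniform :
    ∀ (N : ℕ) (L a₀ : ℝ), 0 < L → 0 < a₀ → 4 * a₀ < L → ∃ C : ℝ, 0 ≤ C ∧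
      ∀ a ℓ : ℝ, 0 < ℓ → ℓ ≤ a → a ≤ a₀ →
      ∀ Ψ : Config N → ℂ, ContDiff ℝ 1 Ψ →
        (∀ (X : Config N) (i : Fin N) (k : Fin 3), Ψ (X + Pi.single i (EuclideanSpace.single k L)) = Ψ X) →
        ∫⁻ X in {X : Config N | ∃ i j : Fin N, i ≠ j ∧ ∃ n : Fin 3 → ℤ,
            a < ‖X i - X j - latticeVec L n‖ ∧ ‖X i - X j - latticeVec L n‖ < a + ℓ} ∩ cellN N L,
            (‖Ψ X‖₊ : ℝ≥0∞) ^ 2 ≤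
          ENNReal.ofReal C *
              (∫⁻ X in {X : Config N | ∃ i j : Fin N, i ≠ j ∧ ∃ n : Fin 3 → ℤ,
                  a - ℓ < ‖X i - X j - latticeVec L n‖ ∧ ‖X i - X j - latticeVec L n‖ ≤ a} ∩ cellN N L,
                  (‖Ψ X‖₊ : ℝ≥0∞) ^ 2) +
            ENNReal.ofReal (C * ℓ ^ 2) *
              ∫⁻ X in {X : Config N | ∃ i j : Fin N, i ≠ j ∧ ∃ n : Fin 3 → ℤ,
                  a - ℓ < ‖X i - X j - latticeVec L n‖ ∧ ‖X i - X j - latticeVec L n‖ < a + ℓ} ∩ cellN N L,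
                  kineticDensity Ψ X := by
  intro N L a₀ hL _ha₀ h4a₀
  refine ⟨((16 * N ^ 2 : ℕ) : ℝ), Nat.cast_nonneg _, fun a ℓ hℓ hℓa haa₀ Ψ hΨ hper => ?_⟩
  have ha : 0 < a := hℓ.trans_le hℓa
  have h4a : 4 * a < L := by linarith
  exact PairShellMass.shell_estimate hL ha h4a hℓ hℓa hΨ hper

end Summit.AtomisticToContinuum.BoseEinsteinCondensation.Cruxes.HardCoreExtension.ThirdLawCurrentFloor

end
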